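import Literature.AnabelianGeometry.SemiGraphs.CoveringGraphEtaleCompat
import Literature.AnabelianGeometry.SemiGraphs.ProfiniteSemiGraphIsoPullbackEquivalence
import Literature.AnabelianGeometry.SemiGraphs.SgATemperedArrows
import HarnessLib

/-!
# Pull-back along an isomorphism OVER a base factors the pull-back of the base morphism, and
# [SemiAnbd] Proposition 3.6 (v) «étale» for tempered ARROWS (route T · TRANSPORT VIII)

Mochizuki, *Semi-graphs of anabelioids*, Publ. RIMS **42** (2006), §3, Proposition 3.6 (iv)–(v), manuscript
p. 39 [cite: MochizukiSemiAnbd2006, Prop 3.6(v) p.39], Remark 2.4.2 p. 26 (the 2-cells of a morphism of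
semi-graphs of anabelioids), Definition 3.4 (i) p. 36 (étale morphisms of temperoids), Definition 3.5 (ii)
p. 37 (tempered coverings).

PROOF-ONLY (cell abc-iut, seat abc-iut-L3-d6, ROUTE T lineage; no `def`, no instance, no named fact).

1. **The composition lemma** `Hom.IsoOver.exists_covPullbackWith_iso`.  For abc-iut-L3-t3's isomorphisms over
   a base `I : Hom.IsoOver p q` (`SgATemperedArrows.lean`: `p : X → P`, `q : Y → P`, `I.iso : X → Y` locally trivial
   and iso on semi-graphs, `I.iso ≫ q = p` on semi-graphs and on constituent groups UP TO CONJUGATION `g_v`, `g_e`)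
   and any 2-cell families `θ_q`, `θ_I` there is a 2-cell family `θ_p` of `p` — the one FORCED by `θ_q`, `θ_I`,
   `g_v`, `g_e` — with `p^*_{θ_p} ≅ q^*_{θ_q} ⋙ (I.iso)^*_{θ_I}` on `B^cov(P)`.  (The tree's `ProfiniteSemiGraph.Hom`
   has no composition; this is the functor-level substitute route T needs.  Only `base_comm`, `hV_comm`, `hE_comm`
   of `I` are used.)
2. ★ **Prop. 3.6 (v) «étale» for tempered arrows of `SgA`** `SgA.IsTemperedCoveringOf.exists_etale`: for
   abc-iut-L3-t3's reading of Def. 3.5 (ii) on arrows — `f : H → G` is a tempered covering when its profinite reading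
   `p` is isomorphic OVER `G` to the covering `G_S → G` of a tempered `S` — and `G` as in Prop. 3.6, coherent: there
   are a 2-cell family `θ` of `p` and an equivalence `E : B^temp(H) ≌ B^temp(G)_S` under which `p^*_θ` IS the slice
   structure functor `T ↦ (S × T → S)` (Def. 3.4 (i) verbatim) — from (1), route T's equivalence
   `Hom.btempPullbackEquiv` (p465754) and the étale clause at `G_S` (`CoveringGraphEtaleCompat`, p490360).
   HONEST SCOPE: the tree's `Hom` records 2-cells only as `∃`, so «the resulting morphism of temperoids» is étale for
   the INDUCED family `θ` (∃); other admissible families differ by the Rmk 2.4.2 indeterminacy (RQ12) — not claimed.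

Nothing here bears on [IUTchIII] Cor. 3.12; typed ≠ proved elsewhere.
-/

noncomputable section

open CategoryTheory Topology

namespace Literature.AnabelianGeometry.SemiGraphs

open Literature.AlgebraicGeometry.Frobenioids.QuasiTemperoid.BTempConnected (hom_ρ hom_ext_apply
  ρ_one_apply ρ_mul_apply ρ_inv_apply)

universe u

namespace ProfiniteSemiGraph

variable {X Y P : ProfiniteSemiGraph.{u}}

/-- **Pull-back along an isomorphism over a base factors the pull-back of the base morphism**: for
`I : Hom.IsoOver p q` and 2-cell families `θ_q`, `θ_I`, some 2-cell family `θ_p` of `p` satisfies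
`p^*_{θ_p} ≅ q^*_{θ_q} ⋙ (I.iso)^*_{θ_I}`.  The family is
`θ_p(b) = g_v⁻¹ · q(θ_I(b)) · θ_q(I b) · (q I b)_*(g_e)` for the conjugating elements `g_v`, `g_e` of `I`; the
isomorphism acts by `g_v` on vertex fibres and by `g_e` on edge fibres.
[cite: MochizukiSemiAnbd2006, Prop 3.6(iv) p.39] -/
theorem Hom.IsoOver.exists_covPullbackWith_iso {p : Hom X P} {q : Hom Y P} (I : Hom.IsoOver p q)
    (θq : q.ConjugatorFamily) (θI : I.iso.ConjugatorFamily) :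
    ∃ θp : p.ConjugatorFamily,
      Nonempty (p.covPullbackWith θp ≅ q.covPullbackWith θq ⋙ I.iso.covPullbackWith θI) := by
  obtain ⟨iso, _, _, hbase, hVc, hEc⟩ := I
  obtain ⟨base, hV, hE, comm⟩ := p
  dsimp only at hbase hVc hEc θI ⊢
  subst hbase
  -- the conjugating elements of `I`, casts along the (now definitional) base equalities removed; every
  -- element is read in the constituent groups of `P` indexed through `q ∘ I`
  choose gV hgV using hVc
  choose gE hgE using hEc
  -- the same data read in the constituent groups of `P` indexed through `q ∘ I` (definitionally equal types)
  let hV' : ∀ v : X.graph.Vertex, X.Gv v →ₜ* P.Gv (q.base.vertexMap (iso.base.vertexMap v)) := hV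
  let hE' : ∀ e : X.graph.Edge, X.Ge e →ₜ* P.Ge (q.base.edgeMap (iso.base.edgeMap e)) := hE
  let gV' : ∀ v : X.graph.Vertex, P.Gv (q.base.vertexMap (iso.base.vertexMap v)) := gV
  let gE' : ∀ e : X.graph.Edge, P.Ge (q.base.edgeMap (iso.base.edgeMap e)) := gE
  have hgV' : ∀ (v : X.graph.Vertex) (x : X.Gv v),
      q.hV (iso.base.vertexMap v) (iso.hV v x) = gV' v * hV' v x * (gV' v)⁻¹ := fun v x => hgV v x
  have hgE' : ∀ (e : X.graph.Edge) (x : X.Ge e),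
      q.hE (iso.base.edgeMap e) (iso.hE e x) = gE' e * hE' e x * (gE' e)⁻¹ := fun e x => hgE e x
  -- bookkeeping of indices along a branch `b` of `e = edgeOf b` abutting to `v`
  have e₃ : ∀ b : X.graph.Branch,
      q.base.edgeMap (iso.base.edgeMap (X.graph.edgeOf b)) =
        P.graph.edgeOf (q.base.branchMap (iso.base.branchMap b)) :=
    fun b => (((show X.graph ⟶ Y.graph from iso.base) ≫ (show Y.graph ⟶ P.graph from q.base)).edgeOf_branchMap
      b).symm
  have e₁ : ∀ b : X.graph.Branch, iso.base.edgeMap (X.graph.edgeOf b) = Y.graph.edgeOf (iso.base.branchMap b) :=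
    fun b => (iso.base.edgeOf_branchMap b).symm
  have habP : ∀ (b : X.graph.Branch) (v : X.graph.Vertex) (h : X.graph.abuts b = some v),
      P.graph.abuts (q.base.branchMap (iso.base.branchMap b)) =
        some (q.base.vertexMap (iso.base.vertexMap v)) :=
    fun b v h => q.base.abuts_branchMap _ _ (iso.base.abuts_branchMap b v h)
  -- `brComp` of `p = (I ≫ q, hV, hE)`, of `I` and of `q`, read through `castGe`
  have hbrp : ∀ (b : X.graph.Branch) (v : X.graph.Vertex) (h : X.graph.abuts b = some v)
      (x : X.Ge (X.graph.edgeOf b)),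
      Hom.brComp ⟨(show X.graph ⟶ Y.graph from iso.base) ≫ (show Y.graph ⟶ P.graph from q.base), hV, hE, comm⟩
          b v h x =
        P.brHom _ _ (habP b v h)
          (P.castGe (e₃ b) (hE' (X.graph.edgeOf b) x)) := by
    intro b v h x
    change P.brHomAt _ _ _ _
      (((show X.graph ⟶ Y.graph from iso.base) ≫ (show Y.graph ⟶ P.graph from q.base)).edgeOf_branchMap b)
        (hE (X.graph.edgeOf b) x) = _
    rw [brHomAt_apply,
      eqRec_eq_castGe (((show X.graph ⟶ Y.graph from iso.base) ≫
        (show Y.graph ⟶ P.graph from q.base)).edgeOf_branchMap b)]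
    rfl
  have hbrI : ∀ (b : X.graph.Branch) (v : X.graph.Vertex) (h : X.graph.abuts b = some v)
      (x : X.Ge (X.graph.edgeOf b)),
      iso.brComp b v h x =
        Y.brHom _ _ (iso.base.abuts_branchMap b v h) (Y.castGe (e₁ b) (iso.hE (X.graph.edgeOf b) x)) := by
    intro b v h x
    change Y.brHomAt _ _ _ _ (iso.base.edgeOf_branchMap b) (iso.hE (X.graph.edgeOf b) x) = _
    rw [brHomAt_apply, eqRec_eq_castGe (iso.base.edgeOf_branchMap b)]
  have hbrq : ∀ (b : X.graph.Branch) (v : X.graph.Vertex) (h : X.graph.abuts b = some v)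
      (y : Y.Ge (Y.graph.edgeOf (iso.base.branchMap b))),
      q.brComp (iso.base.branchMap b) (iso.base.vertexMap v) (iso.base.abuts_branchMap b v h) y =
        P.brHom _ _ (habP b v h)
          (P.castGe (q.base.edgeOf_branchMap (iso.base.branchMap b)).symm
            (q.hE (Y.graph.edgeOf (iso.base.branchMap b)) y)) := by
    intro b v h y
    change P.brHomAt _ _ _ _ (q.base.edgeOf_branchMap (iso.base.branchMap b)) (q.hE _ y) = _
    rw [brHomAt_apply, eqRec_eq_castGe (q.base.edgeOf_branchMap (iso.base.branchMap b))]
  -- `q_e ∘ I_e` through the two indexings of the intermediate edge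
  have hqI : ∀ (b : X.graph.Branch) (x : X.Ge (X.graph.edgeOf b)),
      P.castGe (q.base.edgeOf_branchMap (iso.base.branchMap b)).symm
          (q.hE (Y.graph.edgeOf (iso.base.branchMap b)) (Y.castGe (e₁ b) (iso.hE (X.graph.edgeOf b) x))) =
        P.castGe (e₃ b) (q.hE (iso.base.edgeMap (X.graph.edgeOf b)) (iso.hE (X.graph.edgeOf b) x)) := by
    intro b x
    rw [Hom.hE_castGe, castGe_castGe]
  -- the FORCED 2-cell family of `p`
  let θp : Hom.ConjugatorFamily
      ⟨(show X.graph ⟶ Y.graph from iso.base) ≫ (show Y.graph ⟶ P.graph from q.base), hV, hE, comm⟩ :=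
    { θ := fun b v h =>
        (gV' v)⁻¹ *
          q.hV (iso.base.vertexMap v) (θI.θ b v h) *
          θq.θ (iso.base.branchMap b) (iso.base.vertexMap v) (iso.base.abuts_branchMap b v h) *
          P.brHom _ _ (habP b v h)
            (P.castGe (e₃ b) (gE' (X.graph.edgeOf b)))
      spec := by
        intro b v h x
        -- read the goal in the constituent groups of `P` indexed through `q ∘ I`
        change (gV' v)⁻¹ * q.hV (iso.base.vertexMap v) (θI.θ b v h) *
              θq.θ (iso.base.branchMap b) (iso.base.vertexMap v) (iso.base.abuts_branchMap b v h) *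
              P.brHom _ _ (habP b v h) (P.castGe (e₃ b) (gE' (X.graph.edgeOf b))) *
            @id (P.Gv (q.base.vertexMap (iso.base.vertexMap v)))
              (Hom.brComp ⟨(show X.graph ⟶ Y.graph from iso.base) ≫ (show Y.graph ⟶ P.graph from q.base),
                hV, hE, comm⟩ b v h x) *
            ((gV' v)⁻¹ * q.hV (iso.base.vertexMap v) (θI.θ b v h) *
              θq.θ (iso.base.branchMap b) (iso.base.vertexMap v) (iso.base.abuts_branchMap b v h) *
              P.brHom _ _ (habP b v h) (P.castGe (e₃ b) (gE' (X.graph.edgeOf b))))⁻¹ =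
          hV' v (X.brHom b v h x)
        have hx : hE' (X.graph.edgeOf b) x =
            (gE' (X.graph.edgeOf b))⁻¹ * q.hE (iso.base.edgeMap (X.graph.edgeOf b)) (iso.hE (X.graph.edgeOf b) x) *
              gE' (X.graph.edgeOf b) := by
          rw [hgE', ← mul_assoc, ← mul_assoc, inv_mul_cancel, one_mul, mul_assoc, inv_mul_cancel, mul_one]
        have hv : hV' v (X.brHom b v h x) =
            (gV' v)⁻¹ * q.hV (iso.base.vertexMap v) (iso.hV v (X.brHom b v h x)) * gV' v := by
          rw [hgV', ← mul_assoc, ← mul_assoc, inv_mul_cancel, one_mul, mul_assoc, inv_mul_cancel, mul_one]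
        have hq := θq.spec (iso.base.branchMap b) (iso.base.vertexMap v) (iso.base.abuts_branchMap b v h)
          (Y.castGe (e₁ b) (iso.hE (X.graph.edgeOf b) x))
        rw [hbrq b v h, hqI] at hq
        have hI : iso.hV v (X.brHom b v h x) = θI.θ b v h *
            Y.brHom _ _ (iso.base.abuts_branchMap b v h) (Y.castGe (e₁ b) (iso.hE (X.graph.edgeOf b) x)) *
            (θI.θ b v h)⁻¹ := by
          rw [← hbrI b v h x]; exact (θI.spec b v h x).symm
        rw [id, hbrp b v h x, hx, hv, hI, map_mul, map_mul, map_mul, map_mul, map_inv, map_inv, map_mul, map_mul,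
          map_inv]
        rw [show q.hV (iso.base.vertexMap v) (Y.brHom _ _ (iso.base.abuts_branchMap b v h)
            (Y.castGe (e₁ b) (iso.hE (X.graph.edgeOf b) x))) =
            ((q.hV (iso.base.vertexMap v)).comp (Y.brHom _ _ (iso.base.abuts_branchMap b v h)))
              (Y.castGe (e₁ b) (iso.hE (X.graph.edgeOf b) x)) from rfl, ← hq]
        group }
  -- the isomorphism `p^*_{θ_p} T ≅ I^*_{θ_I} (q^*_{θ_q} T)`: act by `g_v` on vertex fibres, by `g_e` on edge fibres
  refine ⟨θp, ⟨NatIso.ofComponents (fun T => CovObj.isoOfComponents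
    (fun v => (BTemp.resIsoOfConj (hV' v) ((q.hV (iso.base.vertexMap v)).comp (iso.hV v)) (gV' v)
      (fun a => (hgV' v a).symm)).app (T.SV (q.base.vertexMap (iso.base.vertexMap v))))
    (fun e => (BTemp.resIsoOfConj (hE' e) ((q.hE (iso.base.edgeMap e)).comp (iso.hE e)) (gE' e)
      (fun a => (hgE' e a).symm)).app (T.SE (q.base.edgeMap (iso.base.edgeMap e))))
    (fun b v h => ?_)) (fun {T T'} f => ?_)⟩⟩
  · -- compatibility with the gluings along `b`
    apply hom_ext_apply
    intro x
    change (((iso.covPullbackWith θI).obj ((q.covPullbackWith θq).obj T)).glue b v h).hom.hom.hom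
        ((T.SE (q.base.edgeMap (iso.base.edgeMap (X.graph.edgeOf b)))).obj.ρ (gE' (X.graph.edgeOf b)) x) =
      (T.SV (q.base.vertexMap (iso.base.vertexMap v))).obj.ρ (gV' v)
        ((((Hom.covPullbackWith ⟨(show X.graph ⟶ Y.graph from iso.base) ≫ (show Y.graph ⟶ P.graph from q.base),
          hV, hE, comm⟩ θp).obj T).glue b v h).hom.hom.hom x)
    rw [Hom.covPullbackWith_glue_apply_castPtE, Hom.covPullbackWith_glue_apply_castPtE,
      CovObj.castPtE_covPullbackWith, Hom.covPullbackWith_glue_apply_castPtE, CovObj.castPtE_castPtE,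
      CovObj.castPtE_ρ]
    change (T.SV (q.base.vertexMap (iso.base.vertexMap v))).obj.ρ (q.hV (iso.base.vertexMap v) (θI.θ b v h))
        ((T.SV (q.base.vertexMap (iso.base.vertexMap v))).obj.ρ
          (θq.θ (iso.base.branchMap b) (iso.base.vertexMap v) (iso.base.abuts_branchMap b v h))
          ((T.glue (q.base.branchMap (iso.base.branchMap b)) (q.base.vertexMap (iso.base.vertexMap v))
              (habP b v h)).hom.hom.hom
            ((T.SE (P.graph.edgeOf (q.base.branchMap (iso.base.branchMap b)))).obj.ρ
              (P.castGe (e₃ b) (gE' (X.graph.edgeOf b))) (T.castPtE (e₃ b) x)))) =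
      (T.SV (q.base.vertexMap (iso.base.vertexMap v))).obj.ρ (gV' v)
        ((T.SV (q.base.vertexMap (iso.base.vertexMap v))).obj.ρ
          ((gV' v)⁻¹ * q.hV (iso.base.vertexMap v) (θI.θ b v h) *
              θq.θ (iso.base.branchMap b) (iso.base.vertexMap v) (iso.base.abuts_branchMap b v h) *
              P.brHom _ _ (habP b v h) (P.castGe (e₃ b) (gE' (X.graph.edgeOf b))))
          ((T.glue (q.base.branchMap (iso.base.branchMap b)) (q.base.vertexMap (iso.base.vertexMap v))
              (habP b v h)).hom.hom.hom (T.castPtE (e₃ b) x)))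
    rw [hom_ρ (T.glue (q.base.branchMap (iso.base.branchMap b)) (q.base.vertexMap (iso.base.vertexMap v))
        (habP b v h)).hom, BTemp.res_obj_ρ_apply, ← ρ_mul_apply, ← ρ_mul_apply, ← ρ_mul_apply]
    congr 1
    group
  · -- naturality in `T`
    refine CovHom.ext (funext fun v => ?_) (funext fun e => ?_)
    · apply hom_ext_apply
      intro x
      exact (hom_ρ (f.fV (q.base.vertexMap (iso.base.vertexMap v))) (gV' v) x).symm
    · apply hom_ext_apply
      intro x
      exact (hom_ρ (f.fE (q.base.edgeMap (iso.base.edgeMap e))) (gE' e) x).symm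

end ProfiniteSemiGraph

/-! ### Proposition 3.6 (v) «étale» for tempered arrows of `SgA` -/

namespace SgAQuot.SgA

open SemiGraphOfAnabelioids ProfiniteSemiGraph

variable {H G : SgA.{u, u, u}} {f : H ⟶ G}

/-- ★ **[SemiAnbd] Proposition 3.6 (v) «étale» for tempered ARROWS** (abc-iut-L3-t3's reading of Def. 3.5 (ii)
on arrows of `SgA`, `IsTemperedCoveringOf f`): for `G` as in Proposition 3.6 and coherent and a tempered covering
`f : H → G` — profinite reading `p` isomorphic OVER `G` to `G_S → G` for a tempered `S` — there are a 2-cell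
family `θ` of `p` and an equivalence `E : B^temp(H) ≌ B^temp(G)_S` under which the pull-back `p^*_θ` IS the slice
structure functor `T ↦ (S × T → S)` (Definition 3.4 (i), as unfolded in `CoveringGraphEtaleCompat`).  `E` is
route T's `(I.iso)^* : B^temp(G_S) ⥲ B^temp(H)` reversed, followed by the étale equivalence at `G_S`; `θ` is the
family forced by the chosen 2-cells of `I.iso` and the `g_{b′}` of Def. 3.5 (i) (honest scope: for THIS induced
family; the tree's `Hom` records 2-cells only as `∃`). Unconditional (`uniformSplitting_holds`).
[cite: MochizukiSemiAnbd2006, Prop 3.6(v) p.39] -/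
theorem IsTemperedCoveringOf.exists_etale (hf : IsTemperedCoveringOf f)
    (h36 : G.toSgA.toProfinite.Prop36Hypotheses) (hcoh : G.toSgA.toProfinite.IsCoherent) :
    ∃ (S : CovObj G.toSgA.toProfinite) (hS : S.IsTempered)
      (θ : (repHomOver f).toProfinite.ConjugatorFamily)
      (E : BTempCat H.toSgA.toProfinite ≌ Over (⟨S, hS⟩ : BTempCat G.toSgA.toProfinite)),
      Nonempty ((repHomOver f).toProfinite.btempPullbackWith θ ⋙ E.functor ≅ S.btempProdOver hS) := by
  obtain ⟨S, hS, ⟨I⟩⟩ := hf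
  haveI := I.isIso_base
  obtain ⟨θ, ⟨Φ⟩⟩ := I.exists_covPullbackWith_iso S.coveringConjugators I.iso.chosenConjugators
  -- route T: pulling back along the isomorphism `I.iso` is an equivalence `B^temp(G_S) ≌ B^temp(H)`
  let Eiso := I.iso.btempPullbackEquiv I.isLocallyTrivial I.iso.chosenConjugators
  let Eet := S.etaleEquiv uniformSplitting_holds h36 hcoh hS
  -- `p^*_θ ≅ q^*_{θ_S} ⋙ (I.iso)^*` on tempered objects
  have Φt : (repHomOver f).toProfinite.btempPullbackWith θ ≅
      S.coveringHom.btempPullbackWith S.coveringConjugators ⋙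
        I.iso.btempPullbackWith I.iso.chosenConjugators :=
    ((ObjectProperty.fullyFaithfulι _).whiskeringRight _).preimageIso
      (Functor.isoWhiskerLeft (ObjectProperty.ι _) Φ)
  refine ⟨S, hS, θ, Eiso.symm.trans Eet, ⟨?_⟩⟩
  exact Functor.isoWhiskerRight Φt (Eiso.inverse ⋙ Eet.functor) ≪≫ Functor.associator _ _ _ ≪≫
    Functor.isoWhiskerLeft (S.coveringHom.btempPullbackWith S.coveringConjugators)
      ((Functor.associator _ _ _).symm ≪≫ Functor.isoWhiskerRight Eiso.unitIso.symm _ ≪≫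
        Functor.leftUnitor _) ≪≫
    S.btempPullbackEtaleFunctorIso hS uniformSplitting_holds h36 hcoh

end SgAQuot.SgA


end Literature.AnabelianGeometry.SemiGraphs

end
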